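import Literature.MathematicalPhysics.QuantumFieldTheory.Balaban1983to89.InfiniteVolumeSufficientXXI
import Literature.LinearAlgebra.Matrix.UnitarySimultaneousSimilarity
import HarnessLib

/-!
# Word traces separate simultaneous-conjugation orbits in `U(N)` and `SU(N)` for EVERY `N`
# ([Sengupta1994] Thm 2) — module XXI's hypothesis `TraceWordsSeparateOrbits (fundamentalRep (Fin N))` DISCHARGED,
# hence `(3a) ⟺ (W-corr)` for `SU(N)` lattice Yang–Mills torus states with no density hypothesis, all `N`

statement-level skeleton of published theorems with citation tags; proofs where landed; nothing here is a claim about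
the Yang–Mills mass gap

Module XXI (`InfiniteVolumeSufficientXXI`) reduced Lévy's density theorem on `ℤ^d`, and with it the equivalence
`(3a) ⟺ (W-corr)` between uniqueness of the infinite-volume limit of the torus states and convergence of all finite
Wilson-loop correlations, to the ONE schema `TraceWordsSeparateOrbits ρ` (equal real and imaginary parts of the traces
of all words `w(V)`, `w(W)` in the letters `i^{±1}` force `W = g V g⁻¹`), proved it for `SU(2)` by `2 × 2` algebra, and
recorded for `SU(N)`, `N ≥ 3`: «in print as Sengupta 1994 Thm 2 p.900, not kernel-proved» (XXI header, PART C and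
"Not claimed"; pub-balaban `ir/SUFFICIENT.md` §26.5 (T-FFT, N ≥ 3)).  This file proves the schema for the defining
representations of `U(N)` (`traceWordsSeparateOrbits_unitaryGroup`) and `SU(N)` (`traceWordsSeparateOrbits_suN`) for
EVERY `N`, from the classical theorem that finite-dimensional unitary representations with equal characters are
unitarily equivalent, applied to the free group on the index set
(`Literature.LinearAlgebra.Matrix.exists_unitary_conj_of_trace_freeGroup_lift_eq`, proved in the tree by the
`*`-algebra / Wedderburn route: `StarSubalgebraMatrixUnits`, `TracePreservingStarHom`, `UnitarySimultaneousSimilarity`).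
This is [Sengupta1994] Thm 2 for `U(n)` and `SU(n)` in exactly the form its proof uses (p.900: «It is only this
apparently weaker hypothesis that will be used»; p.901: «The case G = SU(n) is an immediate consequence of the U(n)
case. This is obtained by scaling the y … by a suitable factor to ensure that it lies in SU(n).» — followed here:
`g = c·u` with `c^N = conj(det u)`).  DEVIATION from print: Sengupta proves the `U(n)` case with Weyl's theorem on the
commutant of `⊗^{k} g` (Schur–Weyl duality, not in Mathlib); the tree's proof is the `*`-algebra proof of Specht's
theorem (Wedderburn–Artin + trace = rank + polar unitarisation).

Consequences (module XXI PART C, by name): `traceWordsDense_suN`, `spansGaugeInvariantCylinders_suN` (Lévy's density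
on `ℤ^d`, every `d`, every `N`), and the HEADLINE `hasUniqueInfiniteVolumeLimit_iff_hasWilsonLoopCorrelationLimits_suN`:
for `SU(N)` lattice Yang–Mills in any dimension at any real `β`, `(3a) ⟺ (W-corr)` with NO hypothesis left — the exact
missing estimate between volume-uniform bounds and the infinite-volume limit is, for every `N`, inter-volume
Cauchy-ness of the torus expectations of finite PRODUCTS of Wilson loops (modules XXII–XXIV: products of two loops are
necessary for `N ≥ 3`).  Nothing about the torus states themselves is proved; NOT summit progress.

v1.1 (namespace alignment only; referee N1 census gen 67, `lean/CONVENTIONS.md` §2 «Literature namespaces are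
TOPIC-ALIGNED = THE FILE'S PATH», cell rule «one namespace per Literature/<AuthorYear> directory»): the eleven
declarations of v1 (p331019), previously opened in the bare namespace `Literature.MathematicalPhysics.QuantumFieldTheory`
after the convention of the `InfiniteVolumeSufficient` series, now live in
`Literature.MathematicalPhysics.QuantumFieldTheory.Balaban1983to89.TraceWordsSeparateOrbitsUnitary`; statements and
proofs are byte-identical, no declaration is added or removed, and v1 had no importer in the tree.
-/

namespace Literature.MathematicalPhysics.QuantumFieldTheory.Balaban1983to89.TraceWordsSeparateOrbitsUnitary

open Literature.MathematicalPhysics.QuantumLattice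
open Balaban1983to89.Missing (TraceWordsSeparateOrbits TraceWordsDense SpansGaugeInvariantCylinders
  HasWilsonLoopCorrelationLimits)
open scoped Matrix ComplexConjugate

section Words

variable {G : Type*} [Group G] {N : ℕ} (ρ : G →* Matrix (Fin N) (Fin N) ℂ)

/-- Module XX's word value IS the free-group evaluation: `wordVal w V = FreeGroup.lift V ⟦w⟧` (same letter convention
`(i, true) ↦ V i`, `(i, false) ↦ (V i)⁻¹`; Lévy 2004 Example 3.3's `w(g)`). [cite: Levy2004, Example 3.3] -/
theorem wordVal_eq_freeGroup_lift {ι : Type*} (w : List (ι × Bool)) (V : ι → G) :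
    wordVal w V = FreeGroup.lift V (FreeGroup.mk w) := by
  rw [FreeGroup.lift_mk, wordVal]
  congr 1
  refine List.map_congr_left fun a _ => ?_
  rcases a with ⟨i, _ | _⟩ <;> simp [letterVal]

/-- Equal `Re` and `Im` parts of the word traces (module XXI's hypothesis) ⟹ equal complex traces of `ρ(w(V))`,
`ρ(w(W))` for every element `w` of the free group. [folklore] -/
private theorem trace_freeGroup_lift_eq_of_tracePart_eq {ι : Type*} (V W : ι → G)
    (h : ∀ (w : List (ι × Bool)) (b : Bool), tracePart ρ b (wordVal w V) = tracePart ρ b (wordVal w W))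
    (w : FreeGroup ι) : (ρ (FreeGroup.lift V w)).trace = (ρ (FreeGroup.lift W w)).trace := by
  classical
  rw [← FreeGroup.mk_toWord (x := w), ← wordVal_eq_freeGroup_lift, ← wordVal_eq_freeGroup_lift]
  exact Complex.ext (h _ true) (h _ false)

end Words

section Unitary

variable {N : ℕ}

/-- **[Sengupta1994] Thm 2 for `U(N)`: WORD TRACES SEPARATE THE SIMULTANEOUS-CONJUGATION ORBITS OF `U(N)^ι`, every
`N`** — `TraceWordsSeparateOrbits (unitaryFundamentalRep (Fin N) ℂ)`: if `Re/Im tr w(V) = Re/Im tr w(W)` for all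
words `w` in `i^{±1}`, then `W i = g V i g⁻¹` for one `g ∈ U(N)`. [cite: Sengupta1994, Thm 2 p.900] -/
theorem traceWordsSeparateOrbits_unitaryGroup (N : ℕ) :
    TraceWordsSeparateOrbits (unitaryFundamentalRep (Fin N) ℂ) := by
  intro ι _ V W h
  have hρ : ∀ g : Matrix.unitaryGroup (Fin N) ℂ,
      (unitaryFundamentalRep (Fin N) ℂ g)ᴴ = unitaryFundamentalRep (Fin N) ℂ g⁻¹ := fun g => by
    rw [unitaryFundamentalRep_apply, unitaryFundamentalRep_apply, ← Matrix.star_eq_conjTranspose]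
    rfl
  obtain ⟨u, hu, hc⟩ := Literature.LinearAlgebra.Matrix.exists_unitary_conj_of_trace_freeGroup_lift_eq
    (unitaryFundamentalRep (Fin N) ℂ) hρ V W (trace_freeGroup_lift_eq_of_tracePart_eq _ V W h)
  refine ⟨⟨u, hu⟩, fun i => Subtype.ext ?_⟩
  have hi := hc i
  rw [unitaryFundamentalRep_apply, unitaryFundamentalRep_apply] at hi
  rw [hi]
  change _ = u * (V i : Matrix (Fin N) (Fin N) ℂ) * star u
  rw [Matrix.star_eq_conjTranspose]

/-- **[Sengupta1994] Thm 2 for `SU(N)` — MODULE XXI's HYPOTHESIS FOR EVERY `N`:**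
`TraceWordsSeparateOrbits (fundamentalRep (Fin N))`.  Equal real and imaginary parts of the traces of all words in
`V_i^{±1}` and in `W_i^{±1}` (`V, W : ι → SU(N)`, `ι` finite) force `W = g V g⁻¹` for a single `g ∈ SU(N)`.  From the
`U(N)` statement by rescaling the conjugating unitary `u` to `c·u`, `c^N = conj(det u)` (Sengupta p.901: «obtained by
scaling the y … by a suitable factor to ensure that it lies in SU(n)»). [cite: Sengupta1994, Thm 2 pp.900–901] -/
theorem traceWordsSeparateOrbits_suN (N : ℕ) : TraceWordsSeparateOrbits (fundamentalRep (Fin N)) := by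
  intro ι _ V W h
  rcases Nat.eq_zero_or_pos N with hN | hN
  · subst hN
    refine ⟨1, fun i => Subtype.ext (Subsingleton.elim _ _)⟩
  have hρ : ∀ g : Matrix.specialUnitaryGroup (Fin N) ℂ, (fundamentalRep (Fin N) g)ᴴ = fundamentalRep (Fin N) g⁻¹ :=
    fun g => by
      rw [fundamentalRep_apply, fundamentalRep_apply, ← Matrix.star_eq_conjTranspose, ← Matrix.star_eq_inv]
      rfl
  obtain ⟨u, hu, hc⟩ := Literature.LinearAlgebra.Matrix.exists_unitary_conj_of_trace_freeGroup_lift_eq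
    (fundamentalRep (Fin N)) hρ V W (trace_freeGroup_lift_eq_of_tracePart_eq _ V W h)
  simp only [fundamentalRep_apply] at hc
  -- rescale `u` into `SU(N)`
  have hdet : star u.det * u.det = 1 := (Unitary.mem_iff.mp (Matrix.det_of_mem_unitary hu)).1
  obtain ⟨c, hcN⟩ := IsAlgClosed.exists_pow_nat_eq (star u.det) hN
  have hnorm_det : ‖u.det‖ = 1 := by
    have h2 : ‖u.det‖ * ‖u.det‖ = 1 := by
      have := congrArg norm hdet
      rwa [norm_mul, norm_star, norm_one] at this
    rcases mul_self_eq_one_iff.mp h2 with h3 | h3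
    · exact h3
    · linarith [norm_nonneg u.det]
  have hnorm_c : ‖c‖ = 1 := by
    have h1 : ‖c‖ ^ N = 1 := by rw [← norm_pow, hcN, Complex.star_def, Complex.norm_conj, hnorm_det]
    exact (pow_eq_one_iff_of_nonneg (norm_nonneg c) hN.ne').mp h1
  have hcc : star c * c = 1 := by
    rw [Complex.star_def, Complex.conj_mul', hnorm_c]
    simp
  have hcc' : c * star c = 1 := by rw [mul_comm, hcc]
  set g : Matrix (Fin N) (Fin N) ℂ := c • u with hg
  have hgU : g ∈ Matrix.unitaryGroup (Fin N) ℂ := by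
    rw [Matrix.mem_unitaryGroup_iff] at hu ⊢
    rw [hg, star_smul, Matrix.smul_mul, Matrix.mul_smul, smul_smul, hcc', one_smul, hu]
  have hgdet : g.det = 1 := by
    rw [hg, Matrix.det_smul, Fintype.card_fin, hcN, hdet]
  have hgSU : g ∈ Matrix.specialUnitaryGroup (Fin N) ℂ :=
    Matrix.mem_specialUnitaryGroup_iff.mpr ⟨hgU, hgdet⟩
  refine ⟨⟨g, hgSU⟩, fun i => Subtype.ext ?_⟩
  change (W i : Matrix (Fin N) (Fin N) ℂ) = g * (V i : Matrix (Fin N) (Fin N) ℂ) * ((⟨g, hgSU⟩ : Matrix.specialUnitaryGroup (Fin N) ℂ)⁻¹ : Matrix.specialUnitaryGroup (Fin N) ℂ)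
  rw [← Matrix.star_eq_inv, Matrix.specialUnitaryGroup.coe_star]
  change (W i : Matrix (Fin N) (Fin N) ℂ) = g * (V i : Matrix (Fin N) (Fin N) ℂ) * star g
  rw [hc i, hg, star_smul]
  simp only [Matrix.smul_mul, Matrix.mul_smul, smul_smul, hcc, one_smul, Matrix.star_eq_conjTranspose]

end Unitary

/-! ## HEADLINES for `SU(N)`, every `N`: density and `(3a) ⟺ (W-corr)` with no hypothesis left -/

section Headlines

variable {d : ℕ}

/-- **`SU(N)`, every `N`: THE SEVERAL-VARIABLE DENSITY SCHEMA OF MODULE XX HOLDS** — polynomials in the word traces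
`Re/Im tr w(V)` are uniformly dense in the continuous functions on `SU(N)^ι` invariant under simultaneous conjugation
(orbit separation + Stone–Weierstrass, module XXI PART C). [cite: Levy2004, Prop 3.4 p.5] -/
theorem traceWordsDense_suN (N : ℕ) : TraceWordsDense (fundamentalRep (Fin N)) :=
  traceWordsDense_of_traceWordsSeparateOrbits _ (continuous_fundamentalRep (Fin N)) (traceWordsSeparateOrbits_suN N)

/-- **`SU(N)`, every `N`: LÉVY'S DENSITY ON `ℤ^d`** — the real span of the finite products of Wilson loops
`Re/Im tr U_ℓ` is sup-norm dense in the gauge-invariant continuous cylinder functions, in every dimension `d`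
(module XX's reduction + `traceWordsDense_suN`). [cite: Levy2004, Thm 3.1 p.5] -/
theorem spansGaugeInvariantCylinders_suN (N : ℕ) :
    SpansGaugeInvariantCylinders d (wilsonLoopProducts (fundamentalRep (Fin N)) d) :=
  spansGaugeInvariantCylinders_of_traceWordsDense _ (traceWordsDense_suN N)

/-- **HEADLINE — `SU(N)` FOR EVERY `N`: `(3a) ⟺ (W-corr)` UNCONDITIONALLY.**  `SU(N)` lattice Yang–Mills theory in
dimension `d` at real coupling `β` has a unique infinite-volume limit of its torus states
(`HasUniqueInfiniteVolumeLimit`) iff every finite Wilson-loop correlation `⟨∏ Re/Im tr U(ℓᵢ)⟩_{𝕋_{L+1},β}` converges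
as `L → ∞` (`HasWilsonLoopCorrelationLimits`).  Module XXI proved this for `N = 2` and, for general `N`, conditionally
on `TraceWordsSeparateOrbits (fundamentalRep (Fin N))`; that hypothesis is now a theorem (`traceWordsSeparateOrbits_suN`).
[cite: Levy2004, Thm 3.1 p.5] -/
theorem hasUniqueInfiniteVolumeLimit_iff_hasWilsonLoopCorrelationLimits_suN (N : ℕ) (β : ℝ) :
    HasUniqueInfiniteVolumeLimit (d := d) (fundamentalRep (Fin N)) β ↔
      HasWilsonLoopCorrelationLimits (fundamentalRep (Fin N)) d β := by
  haveI := specialUnitaryGroup_secondCountable (Fin N)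
  exact hasUniqueInfiniteVolumeLimit_iff_hasWilsonLoopCorrelationLimits_of_traceWordsSeparateOrbits _
    (continuous_fundamentalRep (Fin N)) (traceWordsSeparateOrbits_suN N) β

/-- `U(n)` is second countable (a subspace of `Matrix n n ℂ`). [folklore] -/
private theorem unitaryGroup_secondCountable (n : Type*) [Fintype n] [DecidableEq n] :
    SecondCountableTopology (Matrix.unitaryGroup n ℂ) :=
  haveI : SecondCountableTopology (Matrix n n ℂ) := inferInstanceAs (SecondCountableTopology (n → n → ℂ))
  Topology.IsEmbedding.subtypeVal.secondCountableTopology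

/-- **`U(N)`, every `N`: the several-variable density schema of module XX holds.** [cite: Levy2004, Prop 3.4 p.5] -/
theorem traceWordsDense_unitaryGroup (N : ℕ) : TraceWordsDense (unitaryFundamentalRep (Fin N) ℂ) :=
  traceWordsDense_of_traceWordsSeparateOrbits _ (continuous_unitaryFundamentalRep (Fin N) ℂ)
    (traceWordsSeparateOrbits_unitaryGroup N)

/-- **`U(N)`, every `N`: Lévy's density on `ℤ^d`.** [cite: Levy2004, Thm 3.1 p.5] -/
theorem spansGaugeInvariantCylinders_unitaryGroup (N : ℕ) :
    SpansGaugeInvariantCylinders d (wilsonLoopProducts (unitaryFundamentalRep (Fin N) ℂ) d) :=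
  spansGaugeInvariantCylinders_of_traceWordsDense _ (traceWordsDense_unitaryGroup N)

/-- **`U(N)` FOR EVERY `N`: `(3a) ⟺ (W-corr)` UNCONDITIONALLY** (compact `U(N)` lattice gauge theory, any `d`, any
real `β`). [cite: Levy2004, Thm 3.1 p.5] -/
theorem hasUniqueInfiniteVolumeLimit_iff_hasWilsonLoopCorrelationLimits_unitaryGroup (N : ℕ) (β : ℝ) :
    HasUniqueInfiniteVolumeLimit (d := d) (unitaryFundamentalRep (Fin N) ℂ) β ↔
      HasWilsonLoopCorrelationLimits (unitaryFundamentalRep (Fin N) ℂ) d β := by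
  haveI := unitaryGroup_secondCountable (Fin N)
  exact hasUniqueInfiniteVolumeLimit_iff_hasWilsonLoopCorrelationLimits_of_traceWordsSeparateOrbits _
    (continuous_unitaryFundamentalRep (Fin N) ℂ) (traceWordsSeparateOrbits_unitaryGroup N) β

end Headlines

end Literature.MathematicalPhysics.QuantumFieldTheory.Balaban1983to89.TraceWordsSeparateOrbitsUnitary
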